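/-
Copyright (c) 2026 the pub-hodgecm-mathlib formalisation cell (harness21).  Prover seat hodgecm-mathlib-LH5-p04 (g7): sub-road «LH5c-SIM» (LEAD F0P3a-plan (g15) T14-38 F1,
desk F0P3-plan (g18) 19:49Z), the (i-c) JUNCTION of SIGSHEET v1 fbaf33cb393bfb46 ∕ v3 8caf17033962af60 (LHref-S BOX #15 ∕ #17 «=»), 2026-09-02.
-/
import Literature.NumberTheory.Rogawski1990.TamagawaBlockModelCovolOfSingleBlocks   -- ★ (R4) junction p852390: every token of the Z1♭♭ₐ letter; its `hA` slot is what this file's conclusion fills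
import HarnessLib

/-!
# The (i-c) junction «Z1♭♭ₐ ⟸ SIMILAR ∧ INNER»: rank-two recipe-covolume invariance follows from the SIMILAR-pairs case and the GENUINE-INNER-FORMS case
(Rogawski 1990 §14.5 Lemma 14.5.2 (b) pp. 238–239; Kottwitz 1988 Thm. 1; Platonov–Rapinchuk 1994 §2.3)

Topic `NumberTheory/Rogawski1990`; namespace `Literature.NumberTheory.Rogawski1990.TamagawaBlockModel` (the (R4) junction's).  THEOREMS ONLY (no definition, no instance,
no notation, no named fact, no `sorry`).  Cell `pub/hodgecm-mathlib`, crux H413 = `stmt-HodgeConjecture-24833` (supports-only, count-neutral), half A line LH5, third-layer leaf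
`Cruxes/H413/Lines/F0_P3c_TprimeJPaydown.lean` ED. 4 (2084b16633fbd477), organ Z1♭♭ₐ `stub_rankTwoRecipeCovolEq` :153 (PRINT [Kottwitz1988 Thm 1]).  Sub-road «LH5c-SIM»
(LEAD T14-38): re-letter Z1♭♭ₐ to EXACTLY the cited sentence — genuine inner forms — with the similar-pairs half PROVED in house.

THE STATEMENT.  `rankTwoRecipeCovolEq_of_similar_of_inner (hsim) (hinner) : ‹Z1♭♭ₐ›`, where `hsim` = Z1♭♭ₐ's two-sided letter with the four extra binders
`(c : L) (_ : c ≠ 0) (Q : GL (Fin 2) L) (_ : ᵗ(σQ)·Ha·Q = c • Ha′)` («SIMILAR pairs»: the two hermitian planes differ by a rational similitude — IN-HOUSE, ★ `recipeCovol_eq_of_similar`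
at `N = 2`, transport of structure) and `hinner` = Z1♭♭ₐ's letter with the one extra binder `(_ : ¬ ∃ c Q, c ≠ 0 ∧ ᵗ(σQ)·Ha·Q = c • Ha′)` («NON-SIMILAR pairs» = distinct local
invariants = genuine inner forms `U(1,1)_v` vs anisotropic `U(2)_v`: the organ♮ Z1♭♭ₐ♮, PRINT — Kottwitz's inner-twist invariance `τ(U(W₂)) = τ(U(W₂′))`, [Kottwitz1988 Thm 1]
as used in [Rogawski1990] L. 14.5.2 (b) p. 239).  PROOF: classical `by_cases` on the similitude proposition — five lines; no classification lemma, no intermediate recipe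
(LEAD's KILL test, LHref-S BOX #15 (4)).  Both hypotheses are BINDERS, so this file is a closed TRIO theorem; the conclusion is the ★ (R4) junction's `hA` token for token
(LHref-S kernel tie 1baf98cafb49f682).
HONEST LABEL: count-neutral junction; the print floor of Z1♭♭ₐ is NOT lowered (the non-similar half stays PRINT, acq-15102 [Kottwitz1988] open); HC_CM is proved only modulo
the 7 printed citations (2 remaining: hLiu418 = `stmt-HodgeConjecture-24832`, h413 = `stmt-HodgeConjecture-24833`) until rung 0 closes.

## References
* [Rogawski1990] J. D. Rogawski, *Automorphic Representations of Unitary Groups in Three Variables*, Ann. of Math. Stud. 123 (1990), §14.5 Lemma 14.5.2 (b) pp. 238–239; §1.7 p. 6.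
* [Kottwitz1988] R. E. Kottwitz, Tamagawa numbers, Ann. of Math. 127 (1988), Thm. 1 (not held, acq-15102; secondary: [PlatonovRapinchuk1994] §5.3).
* [PlatonovRapinchuk1994] V. Platonov, A. Rapinchuk, *Algebraic Groups and Number Theory* (1994), §2.3 (similar hermitian forms, conjugate unitary groups), §5.3.
-/

set_option autoImplicit false

noncomputable section

open MeasureTheory Measure NumberField IsDedekindDomain
open Literature.MeasureTheory.Group Literature.MeasureTheory.RestrictedProduct
open Literature.Topology.RestrictedProduct Literature.Topology.Algebra.RestrictedProduct
open Literature.NumberTheory.Rogawski1990 Literature.NumberTheory.Automorphic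
open Literature.AlgebraicGeometry.ShimuraVarieties (unitaryGroup hermForm)
open scoped Matrix MatrixGroups RestrictedProduct

namespace Literature.NumberTheory.Rogawski1990.TamagawaBlockModel

section Junction

variable (L : Type) [Field L] [NumberField L] [IsCMField L]

set_option maxHeartbeats 16000000 in
set_option synthInstance.maxHeartbeats 800000 in
/-- **THE (i-c) JUNCTION «Z1♭♭ₐ ⟸ SIMILAR ∧ INNER».**  If the rank-two recipe covolumes agree for every pair of anisotropic hermitian planes related by a rational SIMILITUDE
`ᵗ(σQ)·Ha·Q = c • Ha′` (`hsim`, in-house) and for every NON-SIMILAR pair (`hinner`, the genuine inner forms — PRINT [Kottwitz1988 Thm 1]), then they agree for every pair: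
organ Z1♭♭ₐ `stub_rankTwoRecipeCovolEq` of LH5c ED. 4 TOKEN FOR TOKEN (= the `hA` slot of ★ `blockModelCovolEq_of_singleBlockCovolEq`).  Classical case split, nothing else.
[cite: Rogawski1990, §14.5 Lemma 14.5.2 (b) pp. 238–239] [cite: Kottwitz1988, Thm. 1] [cite: PlatonovRapinchuk1994, §2.3] -/
theorem rankTwoRecipeCovolEq_of_similar_of_inner
    (hsim : ∀ (wv : ∀ v : HeightOneSpectrum (𝓞 ↥(maximalRealSubfield L)), UnitaryGroup.PlacesOver L v) (s : HeightOneSpectrum (𝓞 ↥(maximalRealSubfield L)) → Bool)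
        (_ : ∀ v, s v = true ↔ IsCMField.complexConj L • (wv v).1 ≠ (wv v).1)
        (Ha : Matrix (Fin 2) (Fin 2) L) (_ : (Ha.map (cmConjRingHom L)).transpose = Ha) (_ : ∀ x : Fin 2 → L, hermForm (cmConjRingHom L) Ha x x = 0 → x = 0)
        [MeasurableSpace (UnitaryGroup.cmDatum L 2 Ha).Adelic] [BorelSpace (UnitaryGroup.cmDatum L 2 Ha).Adelic]
        [MeasurableSpace (UnitaryGroup.arch (↥(maximalRealSubfield L)) L (IsCMField.complexConj L) 2 Ha)] [BorelSpace (UnitaryGroup.arch (↥(maximalRealSubfield L)) L (IsCMField.complexConj L) 2 Ha)]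
        [MeasurableSpace (UnitaryGroup.archSkew (↥(maximalRealSubfield L)) L (IsCMField.complexConj L) 2 Ha)] [BorelSpace (UnitaryGroup.archSkew (↥(maximalRealSubfield L)) L (IsCMField.complexConj L) 2 Ha)]
        [MeasurableSpace ((UnitaryGroup.cmDatum L 2 Ha).Adelic ⧸ (UnitaryGroup.cmDatum L 2 Ha).quotientSubgroup)] [BorelSpace ((UnitaryGroup.cmDatum L 2 Ha).Adelic ⧸ (UnitaryGroup.cmDatum L 2 Ha).quotientSubgroup)]
        [(count : Measure ↥(UnitaryGroup.cmDatum L 2 Ha).quotientSubgroup).IsHaarMeasure]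
        [MeasurableSpace ↥(UnitaryGroup.finAdelic (↥(maximalRealSubfield L)) L (IsCMField.complexConj L) 2 Ha)] [BorelSpace ↥(UnitaryGroup.finAdelic (↥(maximalRealSubfield L)) L (IsCMField.complexConj L) 2 Ha)]
        (e : ↥(UnitaryGroup.arch (↥(maximalRealSubfield L)) L (IsCMField.complexConj L) 2 Ha) × ↥(UnitaryGroup.finAdelic (↥(maximalRealSubfield L)) L (IsCMField.complexConj L) 2 Ha) ≃* (UnitaryGroup.cmDatum L 2 Ha).Adelic)
        (_ : e = (UnitaryGroup.adelicProdEquiv (↥(maximalRealSubfield L)) L (IsCMField.complexConj L) 2 Ha).symm.toMulEquiv) (_ : Continuous e) (_ : Continuous e.symm)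
        (μ : Measure (UnitaryGroup.cmDatum L 2 Ha).Adelic) (_ : IsHaarMeasure μ) (_ : μ.IsMulRightInvariant),
      (∃ (tf : Measure ↥(UnitaryGroup.finAdelic (↥(maximalRealSubfield L)) L (IsCMField.complexConj L) 2 Ha)),
            IsHaarMeasure tf ∧
            tf {z : ↥(UnitaryGroup.finAdelic (↥(maximalRealSubfield L)) L (IsCMField.complexConj L) 2 Ha) | z ∈ UnitaryGroup.finAdelicIntegralLevel (↥(maximalRealSubfield L)) L (IsCMField.complexConj L) 2 Ha} =
              ENNReal.ofReal (∏' v : HeightOneSpectrum (𝓞 ↥(maximalRealSubfield L)), (1 - (if s v then (1 : ℝ) else -1) * ((Ideal.absNorm v.asIdeal : ℝ)⁻¹))⁻¹ * ((Literature.NumberTheory.Weil1982.UnitaryFinTopForm.tamagawaDensity L 2 Ha v 1 : NNReal) : ℝ)) ∧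
            (Multipliable (fun v : HeightOneSpectrum (𝓞 ↥(maximalRealSubfield L)) => (1 - (if s v then (1 : ℝ) else -1) * ((Ideal.absNorm v.asIdeal : ℝ)⁻¹))⁻¹ * ((Literature.NumberTheory.Weil1982.UnitaryFinTopForm.tamagawaDensity L 2 Ha v 1 : NNReal) : ℝ)) ∧
              0 < ∏' v : HeightOneSpectrum (𝓞 ↥(maximalRealSubfield L)), (1 - (if s v then (1 : ℝ) else -1) * ((Ideal.absNorm v.asIdeal : ℝ)⁻¹))⁻¹ * ((Literature.NumberTheory.Weil1982.UnitaryFinTopForm.tamagawaDensity L 2 Ha v 1 : NNReal) : ℝ)) ∧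
            μ = Measure.map e ((Literature.NumberTheory.Weil1964.UnitaryArchTopForm.archTopFormHaar (↥(maximalRealSubfield L)) L (IsCMField.complexConj L) 2 Ha).prod tf)) →
      ∀ (Ha' : Matrix (Fin 2) (Fin 2) L) (_ : (Ha'.map (cmConjRingHom L)).transpose = Ha') (_ : ∀ x : Fin 2 → L, hermForm (cmConjRingHom L) Ha' x x = 0 → x = 0)
        (c : L) (_ : c ≠ 0) (Q : GL (Fin 2) L) (_ : (((Q : GL (Fin 2) L) : Matrix (Fin 2) (Fin 2) L).map (cmConjRingHom L))ᵀ * Ha * ((Q : GL (Fin 2) L) : Matrix (Fin 2) (Fin 2) L) = c • Ha')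
        [MeasurableSpace (UnitaryGroup.cmDatum L 2 Ha').Adelic] [BorelSpace (UnitaryGroup.cmDatum L 2 Ha').Adelic]
        [MeasurableSpace (UnitaryGroup.arch (↥(maximalRealSubfield L)) L (IsCMField.complexConj L) 2 Ha')] [BorelSpace (UnitaryGroup.arch (↥(maximalRealSubfield L)) L (IsCMField.complexConj L) 2 Ha')]
        [MeasurableSpace (UnitaryGroup.archSkew (↥(maximalRealSubfield L)) L (IsCMField.complexConj L) 2 Ha')] [BorelSpace (UnitaryGroup.archSkew (↥(maximalRealSubfield L)) L (IsCMField.complexConj L) 2 Ha')]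
        [MeasurableSpace ((UnitaryGroup.cmDatum L 2 Ha').Adelic ⧸ (UnitaryGroup.cmDatum L 2 Ha').quotientSubgroup)] [BorelSpace ((UnitaryGroup.cmDatum L 2 Ha').Adelic ⧸ (UnitaryGroup.cmDatum L 2 Ha').quotientSubgroup)]
        [(count : Measure ↥(UnitaryGroup.cmDatum L 2 Ha').quotientSubgroup).IsHaarMeasure]
        [MeasurableSpace ↥(UnitaryGroup.finAdelic (↥(maximalRealSubfield L)) L (IsCMField.complexConj L) 2 Ha')] [BorelSpace ↥(UnitaryGroup.finAdelic (↥(maximalRealSubfield L)) L (IsCMField.complexConj L) 2 Ha')]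
        (e' : ↥(UnitaryGroup.arch (↥(maximalRealSubfield L)) L (IsCMField.complexConj L) 2 Ha') × ↥(UnitaryGroup.finAdelic (↥(maximalRealSubfield L)) L (IsCMField.complexConj L) 2 Ha') ≃* (UnitaryGroup.cmDatum L 2 Ha').Adelic)
        (_ : e' = (UnitaryGroup.adelicProdEquiv (↥(maximalRealSubfield L)) L (IsCMField.complexConj L) 2 Ha').symm.toMulEquiv) (_ : Continuous e') (_ : Continuous e'.symm)
        (μ' : Measure (UnitaryGroup.cmDatum L 2 Ha').Adelic) (_ : IsHaarMeasure μ') (_ : μ'.IsMulRightInvariant),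
      (∃ (tf : Measure ↥(UnitaryGroup.finAdelic (↥(maximalRealSubfield L)) L (IsCMField.complexConj L) 2 Ha')),
            IsHaarMeasure tf ∧
            tf {z : ↥(UnitaryGroup.finAdelic (↥(maximalRealSubfield L)) L (IsCMField.complexConj L) 2 Ha') | z ∈ UnitaryGroup.finAdelicIntegralLevel (↥(maximalRealSubfield L)) L (IsCMField.complexConj L) 2 Ha'} =
              ENNReal.ofReal (∏' v : HeightOneSpectrum (𝓞 ↥(maximalRealSubfield L)), (1 - (if s v then (1 : ℝ) else -1) * ((Ideal.absNorm v.asIdeal : ℝ)⁻¹))⁻¹ * ((Literature.NumberTheory.Weil1982.UnitaryFinTopForm.tamagawaDensity L 2 Ha' v 1 : NNReal) : ℝ)) ∧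
            (Multipliable (fun v : HeightOneSpectrum (𝓞 ↥(maximalRealSubfield L)) => (1 - (if s v then (1 : ℝ) else -1) * ((Ideal.absNorm v.asIdeal : ℝ)⁻¹))⁻¹ * ((Literature.NumberTheory.Weil1982.UnitaryFinTopForm.tamagawaDensity L 2 Ha' v 1 : NNReal) : ℝ)) ∧
              0 < ∏' v : HeightOneSpectrum (𝓞 ↥(maximalRealSubfield L)), (1 - (if s v then (1 : ℝ) else -1) * ((Ideal.absNorm v.asIdeal : ℝ)⁻¹))⁻¹ * ((Literature.NumberTheory.Weil1982.UnitaryFinTopForm.tamagawaDensity L 2 Ha' v 1 : NNReal) : ℝ)) ∧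
            μ' = Measure.map e' ((Literature.NumberTheory.Weil1964.UnitaryArchTopForm.archTopFormHaar (↥(maximalRealSubfield L)) L (IsCMField.complexConj L) 2 Ha').prod tf)) →
      quotientMeasure (UnitaryGroup.cmDatum L 2 Ha).quotientSubgroup (count : Measure ↥(UnitaryGroup.cmDatum L 2 Ha).quotientSubgroup) (UnitaryGroup.isClosed_cmDatum_quotientSubgroup L 2 Ha) μ Set.univ =
        quotientMeasure (UnitaryGroup.cmDatum L 2 Ha').quotientSubgroup (count : Measure ↥(UnitaryGroup.cmDatum L 2 Ha').quotientSubgroup) (UnitaryGroup.isClosed_cmDatum_quotientSubgroup L 2 Ha') μ' Set.univ)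
    (hinner : ∀ (wv : ∀ v : HeightOneSpectrum (𝓞 ↥(maximalRealSubfield L)), UnitaryGroup.PlacesOver L v) (s : HeightOneSpectrum (𝓞 ↥(maximalRealSubfield L)) → Bool)
        (_ : ∀ v, s v = true ↔ IsCMField.complexConj L • (wv v).1 ≠ (wv v).1)
        (Ha : Matrix (Fin 2) (Fin 2) L) (_ : (Ha.map (cmConjRingHom L)).transpose = Ha) (_ : ∀ x : Fin 2 → L, hermForm (cmConjRingHom L) Ha x x = 0 → x = 0)
        [MeasurableSpace (UnitaryGroup.cmDatum L 2 Ha).Adelic] [BorelSpace (UnitaryGroup.cmDatum L 2 Ha).Adelic]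
        [MeasurableSpace (UnitaryGroup.arch (↥(maximalRealSubfield L)) L (IsCMField.complexConj L) 2 Ha)] [BorelSpace (UnitaryGroup.arch (↥(maximalRealSubfield L)) L (IsCMField.complexConj L) 2 Ha)]
        [MeasurableSpace (UnitaryGroup.archSkew (↥(maximalRealSubfield L)) L (IsCMField.complexConj L) 2 Ha)] [BorelSpace (UnitaryGroup.archSkew (↥(maximalRealSubfield L)) L (IsCMField.complexConj L) 2 Ha)]
        [MeasurableSpace ((UnitaryGroup.cmDatum L 2 Ha).Adelic ⧸ (UnitaryGroup.cmDatum L 2 Ha).quotientSubgroup)] [BorelSpace ((UnitaryGroup.cmDatum L 2 Ha).Adelic ⧸ (UnitaryGroup.cmDatum L 2 Ha).quotientSubgroup)]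
        [(count : Measure ↥(UnitaryGroup.cmDatum L 2 Ha).quotientSubgroup).IsHaarMeasure]
        [MeasurableSpace ↥(UnitaryGroup.finAdelic (↥(maximalRealSubfield L)) L (IsCMField.complexConj L) 2 Ha)] [BorelSpace ↥(UnitaryGroup.finAdelic (↥(maximalRealSubfield L)) L (IsCMField.complexConj L) 2 Ha)]
        (e : ↥(UnitaryGroup.arch (↥(maximalRealSubfield L)) L (IsCMField.complexConj L) 2 Ha) × ↥(UnitaryGroup.finAdelic (↥(maximalRealSubfield L)) L (IsCMField.complexConj L) 2 Ha) ≃* (UnitaryGroup.cmDatum L 2 Ha).Adelic)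
        (_ : e = (UnitaryGroup.adelicProdEquiv (↥(maximalRealSubfield L)) L (IsCMField.complexConj L) 2 Ha).symm.toMulEquiv) (_ : Continuous e) (_ : Continuous e.symm)
        (μ : Measure (UnitaryGroup.cmDatum L 2 Ha).Adelic) (_ : IsHaarMeasure μ) (_ : μ.IsMulRightInvariant),
      (∃ (tf : Measure ↥(UnitaryGroup.finAdelic (↥(maximalRealSubfield L)) L (IsCMField.complexConj L) 2 Ha)),
            IsHaarMeasure tf ∧
            tf {z : ↥(UnitaryGroup.finAdelic (↥(maximalRealSubfield L)) L (IsCMField.complexConj L) 2 Ha) | z ∈ UnitaryGroup.finAdelicIntegralLevel (↥(maximalRealSubfield L)) L (IsCMField.complexConj L) 2 Ha} =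
              ENNReal.ofReal (∏' v : HeightOneSpectrum (𝓞 ↥(maximalRealSubfield L)), (1 - (if s v then (1 : ℝ) else -1) * ((Ideal.absNorm v.asIdeal : ℝ)⁻¹))⁻¹ * ((Literature.NumberTheory.Weil1982.UnitaryFinTopForm.tamagawaDensity L 2 Ha v 1 : NNReal) : ℝ)) ∧
            (Multipliable (fun v : HeightOneSpectrum (𝓞 ↥(maximalRealSubfield L)) => (1 - (if s v then (1 : ℝ) else -1) * ((Ideal.absNorm v.asIdeal : ℝ)⁻¹))⁻¹ * ((Literature.NumberTheory.Weil1982.UnitaryFinTopForm.tamagawaDensity L 2 Ha v 1 : NNReal) : ℝ)) ∧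
              0 < ∏' v : HeightOneSpectrum (𝓞 ↥(maximalRealSubfield L)), (1 - (if s v then (1 : ℝ) else -1) * ((Ideal.absNorm v.asIdeal : ℝ)⁻¹))⁻¹ * ((Literature.NumberTheory.Weil1982.UnitaryFinTopForm.tamagawaDensity L 2 Ha v 1 : NNReal) : ℝ)) ∧
            μ = Measure.map e ((Literature.NumberTheory.Weil1964.UnitaryArchTopForm.archTopFormHaar (↥(maximalRealSubfield L)) L (IsCMField.complexConj L) 2 Ha).prod tf)) →
      ∀ (Ha' : Matrix (Fin 2) (Fin 2) L) (_ : (Ha'.map (cmConjRingHom L)).transpose = Ha') (_ : ∀ x : Fin 2 → L, hermForm (cmConjRingHom L) Ha' x x = 0 → x = 0)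
        (_ : ¬ ∃ (c : L) (Q : GL (Fin 2) L), c ≠ 0 ∧ (((Q : GL (Fin 2) L) : Matrix (Fin 2) (Fin 2) L).map (cmConjRingHom L))ᵀ * Ha * ((Q : GL (Fin 2) L) : Matrix (Fin 2) (Fin 2) L) = c • Ha')
        [MeasurableSpace (UnitaryGroup.cmDatum L 2 Ha').Adelic] [BorelSpace (UnitaryGroup.cmDatum L 2 Ha').Adelic]
        [MeasurableSpace (UnitaryGroup.arch (↥(maximalRealSubfield L)) L (IsCMField.complexConj L) 2 Ha')] [BorelSpace (UnitaryGroup.arch (↥(maximalRealSubfield L)) L (IsCMField.complexConj L) 2 Ha')]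
        [MeasurableSpace (UnitaryGroup.archSkew (↥(maximalRealSubfield L)) L (IsCMField.complexConj L) 2 Ha')] [BorelSpace (UnitaryGroup.archSkew (↥(maximalRealSubfield L)) L (IsCMField.complexConj L) 2 Ha')]
        [MeasurableSpace ((UnitaryGroup.cmDatum L 2 Ha').Adelic ⧸ (UnitaryGroup.cmDatum L 2 Ha').quotientSubgroup)] [BorelSpace ((UnitaryGroup.cmDatum L 2 Ha').Adelic ⧸ (UnitaryGroup.cmDatum L 2 Ha').quotientSubgroup)]
        [(count : Measure ↥(UnitaryGroup.cmDatum L 2 Ha').quotientSubgroup).IsHaarMeasure]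
        [MeasurableSpace ↥(UnitaryGroup.finAdelic (↥(maximalRealSubfield L)) L (IsCMField.complexConj L) 2 Ha')] [BorelSpace ↥(UnitaryGroup.finAdelic (↥(maximalRealSubfield L)) L (IsCMField.complexConj L) 2 Ha')]
        (e' : ↥(UnitaryGroup.arch (↥(maximalRealSubfield L)) L (IsCMField.complexConj L) 2 Ha') × ↥(UnitaryGroup.finAdelic (↥(maximalRealSubfield L)) L (IsCMField.complexConj L) 2 Ha') ≃* (UnitaryGroup.cmDatum L 2 Ha').Adelic)
        (_ : e' = (UnitaryGroup.adelicProdEquiv (↥(maximalRealSubfield L)) L (IsCMField.complexConj L) 2 Ha').symm.toMulEquiv) (_ : Continuous e') (_ : Continuous e'.symm)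
        (μ' : Measure (UnitaryGroup.cmDatum L 2 Ha').Adelic) (_ : IsHaarMeasure μ') (_ : μ'.IsMulRightInvariant),
      (∃ (tf : Measure ↥(UnitaryGroup.finAdelic (↥(maximalRealSubfield L)) L (IsCMField.complexConj L) 2 Ha')),
            IsHaarMeasure tf ∧
            tf {z : ↥(UnitaryGroup.finAdelic (↥(maximalRealSubfield L)) L (IsCMField.complexConj L) 2 Ha') | z ∈ UnitaryGroup.finAdelicIntegralLevel (↥(maximalRealSubfield L)) L (IsCMField.complexConj L) 2 Ha'} =
              ENNReal.ofReal (∏' v : HeightOneSpectrum (𝓞 ↥(maximalRealSubfield L)), (1 - (if s v then (1 : ℝ) else -1) * ((Ideal.absNorm v.asIdeal : ℝ)⁻¹))⁻¹ * ((Literature.NumberTheory.Weil1982.UnitaryFinTopForm.tamagawaDensity L 2 Ha' v 1 : NNReal) : ℝ)) ∧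
            (Multipliable (fun v : HeightOneSpectrum (𝓞 ↥(maximalRealSubfield L)) => (1 - (if s v then (1 : ℝ) else -1) * ((Ideal.absNorm v.asIdeal : ℝ)⁻¹))⁻¹ * ((Literature.NumberTheory.Weil1982.UnitaryFinTopForm.tamagawaDensity L 2 Ha' v 1 : NNReal) : ℝ)) ∧
              0 < ∏' v : HeightOneSpectrum (𝓞 ↥(maximalRealSubfield L)), (1 - (if s v then (1 : ℝ) else -1) * ((Ideal.absNorm v.asIdeal : ℝ)⁻¹))⁻¹ * ((Literature.NumberTheory.Weil1982.UnitaryFinTopForm.tamagawaDensity L 2 Ha' v 1 : NNReal) : ℝ)) ∧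
            μ' = Measure.map e' ((Literature.NumberTheory.Weil1964.UnitaryArchTopForm.archTopFormHaar (↥(maximalRealSubfield L)) L (IsCMField.complexConj L) 2 Ha').prod tf)) →
      quotientMeasure (UnitaryGroup.cmDatum L 2 Ha).quotientSubgroup (count : Measure ↥(UnitaryGroup.cmDatum L 2 Ha).quotientSubgroup) (UnitaryGroup.isClosed_cmDatum_quotientSubgroup L 2 Ha) μ Set.univ =
        quotientMeasure (UnitaryGroup.cmDatum L 2 Ha').quotientSubgroup (count : Measure ↥(UnitaryGroup.cmDatum L 2 Ha').quotientSubgroup) (UnitaryGroup.isClosed_cmDatum_quotientSubgroup L 2 Ha') μ' Set.univ) :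
    ∀ (wv : ∀ v : HeightOneSpectrum (𝓞 ↥(maximalRealSubfield L)), UnitaryGroup.PlacesOver L v) (s : HeightOneSpectrum (𝓞 ↥(maximalRealSubfield L)) → Bool)
        (_ : ∀ v, s v = true ↔ IsCMField.complexConj L • (wv v).1 ≠ (wv v).1)
        (Ha : Matrix (Fin 2) (Fin 2) L) (_ : (Ha.map (cmConjRingHom L)).transpose = Ha) (_ : ∀ x : Fin 2 → L, hermForm (cmConjRingHom L) Ha x x = 0 → x = 0)
        [MeasurableSpace (UnitaryGroup.cmDatum L 2 Ha).Adelic] [BorelSpace (UnitaryGroup.cmDatum L 2 Ha).Adelic]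
        [MeasurableSpace (UnitaryGroup.arch (↥(maximalRealSubfield L)) L (IsCMField.complexConj L) 2 Ha)] [BorelSpace (UnitaryGroup.arch (↥(maximalRealSubfield L)) L (IsCMField.complexConj L) 2 Ha)]
        [MeasurableSpace (UnitaryGroup.archSkew (↥(maximalRealSubfield L)) L (IsCMField.complexConj L) 2 Ha)] [BorelSpace (UnitaryGroup.archSkew (↥(maximalRealSubfield L)) L (IsCMField.complexConj L) 2 Ha)]
        [MeasurableSpace ((UnitaryGroup.cmDatum L 2 Ha).Adelic ⧸ (UnitaryGroup.cmDatum L 2 Ha).quotientSubgroup)] [BorelSpace ((UnitaryGroup.cmDatum L 2 Ha).Adelic ⧸ (UnitaryGroup.cmDatum L 2 Ha).quotientSubgroup)]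
        [(count : Measure ↥(UnitaryGroup.cmDatum L 2 Ha).quotientSubgroup).IsHaarMeasure]
        [MeasurableSpace ↥(UnitaryGroup.finAdelic (↥(maximalRealSubfield L)) L (IsCMField.complexConj L) 2 Ha)] [BorelSpace ↥(UnitaryGroup.finAdelic (↥(maximalRealSubfield L)) L (IsCMField.complexConj L) 2 Ha)]
        (e : ↥(UnitaryGroup.arch (↥(maximalRealSubfield L)) L (IsCMField.complexConj L) 2 Ha) × ↥(UnitaryGroup.finAdelic (↥(maximalRealSubfield L)) L (IsCMField.complexConj L) 2 Ha) ≃* (UnitaryGroup.cmDatum L 2 Ha).Adelic)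
        (_ : e = (UnitaryGroup.adelicProdEquiv (↥(maximalRealSubfield L)) L (IsCMField.complexConj L) 2 Ha).symm.toMulEquiv) (_ : Continuous e) (_ : Continuous e.symm)
        (μ : Measure (UnitaryGroup.cmDatum L 2 Ha).Adelic) (_ : IsHaarMeasure μ) (_ : μ.IsMulRightInvariant),
      (∃ (tf : Measure ↥(UnitaryGroup.finAdelic (↥(maximalRealSubfield L)) L (IsCMField.complexConj L) 2 Ha)),
            IsHaarMeasure tf ∧
            tf {z : ↥(UnitaryGroup.finAdelic (↥(maximalRealSubfield L)) L (IsCMField.complexConj L) 2 Ha) | z ∈ UnitaryGroup.finAdelicIntegralLevel (↥(maximalRealSubfield L)) L (IsCMField.complexConj L) 2 Ha} =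
              ENNReal.ofReal (∏' v : HeightOneSpectrum (𝓞 ↥(maximalRealSubfield L)), (1 - (if s v then (1 : ℝ) else -1) * ((Ideal.absNorm v.asIdeal : ℝ)⁻¹))⁻¹ * ((Literature.NumberTheory.Weil1982.UnitaryFinTopForm.tamagawaDensity L 2 Ha v 1 : NNReal) : ℝ)) ∧
            (Multipliable (fun v : HeightOneSpectrum (𝓞 ↥(maximalRealSubfield L)) => (1 - (if s v then (1 : ℝ) else -1) * ((Ideal.absNorm v.asIdeal : ℝ)⁻¹))⁻¹ * ((Literature.NumberTheory.Weil1982.UnitaryFinTopForm.tamagawaDensity L 2 Ha v 1 : NNReal) : ℝ)) ∧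
              0 < ∏' v : HeightOneSpectrum (𝓞 ↥(maximalRealSubfield L)), (1 - (if s v then (1 : ℝ) else -1) * ((Ideal.absNorm v.asIdeal : ℝ)⁻¹))⁻¹ * ((Literature.NumberTheory.Weil1982.UnitaryFinTopForm.tamagawaDensity L 2 Ha v 1 : NNReal) : ℝ)) ∧
            μ = Measure.map e ((Literature.NumberTheory.Weil1964.UnitaryArchTopForm.archTopFormHaar (↥(maximalRealSubfield L)) L (IsCMField.complexConj L) 2 Ha).prod tf)) →
      ∀ (Ha' : Matrix (Fin 2) (Fin 2) L) (_ : (Ha'.map (cmConjRingHom L)).transpose = Ha') (_ : ∀ x : Fin 2 → L, hermForm (cmConjRingHom L) Ha' x x = 0 → x = 0)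
        [MeasurableSpace (UnitaryGroup.cmDatum L 2 Ha').Adelic] [BorelSpace (UnitaryGroup.cmDatum L 2 Ha').Adelic]
        [MeasurableSpace (UnitaryGroup.arch (↥(maximalRealSubfield L)) L (IsCMField.complexConj L) 2 Ha')] [BorelSpace (UnitaryGroup.arch (↥(maximalRealSubfield L)) L (IsCMField.complexConj L) 2 Ha')]
        [MeasurableSpace (UnitaryGroup.archSkew (↥(maximalRealSubfield L)) L (IsCMField.complexConj L) 2 Ha')] [BorelSpace (UnitaryGroup.archSkew (↥(maximalRealSubfield L)) L (IsCMField.complexConj L) 2 Ha')]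
        [MeasurableSpace ((UnitaryGroup.cmDatum L 2 Ha').Adelic ⧸ (UnitaryGroup.cmDatum L 2 Ha').quotientSubgroup)] [BorelSpace ((UnitaryGroup.cmDatum L 2 Ha').Adelic ⧸ (UnitaryGroup.cmDatum L 2 Ha').quotientSubgroup)]
        [(count : Measure ↥(UnitaryGroup.cmDatum L 2 Ha').quotientSubgroup).IsHaarMeasure]
        [MeasurableSpace ↥(UnitaryGroup.finAdelic (↥(maximalRealSubfield L)) L (IsCMField.complexConj L) 2 Ha')] [BorelSpace ↥(UnitaryGroup.finAdelic (↥(maximalRealSubfield L)) L (IsCMField.complexConj L) 2 Ha')]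
        (e' : ↥(UnitaryGroup.arch (↥(maximalRealSubfield L)) L (IsCMField.complexConj L) 2 Ha') × ↥(UnitaryGroup.finAdelic (↥(maximalRealSubfield L)) L (IsCMField.complexConj L) 2 Ha') ≃* (UnitaryGroup.cmDatum L 2 Ha').Adelic)
        (_ : e' = (UnitaryGroup.adelicProdEquiv (↥(maximalRealSubfield L)) L (IsCMField.complexConj L) 2 Ha').symm.toMulEquiv) (_ : Continuous e') (_ : Continuous e'.symm)
        (μ' : Measure (UnitaryGroup.cmDatum L 2 Ha').Adelic) (_ : IsHaarMeasure μ') (_ : μ'.IsMulRightInvariant),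
      (∃ (tf : Measure ↥(UnitaryGroup.finAdelic (↥(maximalRealSubfield L)) L (IsCMField.complexConj L) 2 Ha')),
            IsHaarMeasure tf ∧
            tf {z : ↥(UnitaryGroup.finAdelic (↥(maximalRealSubfield L)) L (IsCMField.complexConj L) 2 Ha') | z ∈ UnitaryGroup.finAdelicIntegralLevel (↥(maximalRealSubfield L)) L (IsCMField.complexConj L) 2 Ha'} =
              ENNReal.ofReal (∏' v : HeightOneSpectrum (𝓞 ↥(maximalRealSubfield L)), (1 - (if s v then (1 : ℝ) else -1) * ((Ideal.absNorm v.asIdeal : ℝ)⁻¹))⁻¹ * ((Literature.NumberTheory.Weil1982.UnitaryFinTopForm.tamagawaDensity L 2 Ha' v 1 : NNReal) : ℝ)) ∧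
            (Multipliable (fun v : HeightOneSpectrum (𝓞 ↥(maximalRealSubfield L)) => (1 - (if s v then (1 : ℝ) else -1) * ((Ideal.absNorm v.asIdeal : ℝ)⁻¹))⁻¹ * ((Literature.NumberTheory.Weil1982.UnitaryFinTopForm.tamagawaDensity L 2 Ha' v 1 : NNReal) : ℝ)) ∧
              0 < ∏' v : HeightOneSpectrum (𝓞 ↥(maximalRealSubfield L)), (1 - (if s v then (1 : ℝ) else -1) * ((Ideal.absNorm v.asIdeal : ℝ)⁻¹))⁻¹ * ((Literature.NumberTheory.Weil1982.UnitaryFinTopForm.tamagawaDensity L 2 Ha' v 1 : NNReal) : ℝ)) ∧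
            μ' = Measure.map e' ((Literature.NumberTheory.Weil1964.UnitaryArchTopForm.archTopFormHaar (↥(maximalRealSubfield L)) L (IsCMField.complexConj L) 2 Ha').prod tf)) →
      quotientMeasure (UnitaryGroup.cmDatum L 2 Ha).quotientSubgroup (count : Measure ↥(UnitaryGroup.cmDatum L 2 Ha).quotientSubgroup) (UnitaryGroup.isClosed_cmDatum_quotientSubgroup L 2 Ha) μ Set.univ =
        quotientMeasure (UnitaryGroup.cmDatum L 2 Ha').quotientSubgroup (count : Measure ↥(UnitaryGroup.cmDatum L 2 Ha').quotientSubgroup) (UnitaryGroup.isClosed_cmDatum_quotientSubgroup L 2 Ha') μ' Set.univ := by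
  intro wv s hs Ha hHa hanis _ _ _ _ _ _ _ _ _ _ _ e he hec hes μ hμ hμr hrec Ha' hHa' hanis' _ _ _ _ _ _ _ _ _ _ _ e' he' hec' hes' μ' hμ' hμr' hrec'
  by_cases h : ∃ (c : L) (Q : GL (Fin 2) L), c ≠ 0 ∧ (((Q : GL (Fin 2) L) : Matrix (Fin 2) (Fin 2) L).map (cmConjRingHom L))ᵀ * Ha * ((Q : GL (Fin 2) L) : Matrix (Fin 2) (Fin 2) L) = c • Ha'
  · obtain ⟨c, Q, hc, hQ⟩ := h
    exact hsim wv s hs Ha hHa hanis e he hec hes μ hμ hμr hrec Ha' hHa' hanis' c hc Q hQ e' he' hec' hes' μ' hμ' hμr' hrec'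
  · exact hinner wv s hs Ha hHa hanis e he hec hes μ hμ hμr hrec Ha' hHa' hanis' h e' he' hec' hes' μ' hμ' hμr' hrec'

end Junction

end Literature.NumberTheory.Rogawski1990.TamagawaBlockModel

end
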